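import Mathlib
import HarnessLib
import Summits.Ventures.LatticeQCDFlow.Exactness.KickAngleJacobian
import Summits.Ventures.LatticeQCDFlow.Exactness.SphereGeodesicKick
import Summits.Ventures.LatticeQCDFlow.Exactness.SphereLOFlowAction
import Summits.Ventures.LatticeQCDFlow.Exactness.SphereLOFlowDivergence

/-!
# Leading-order trivialization, at first order in the step: along the Engel–Schaefer map the effective action `S∘F_ε − Σ ln 𝒥_n` changes at rate `−(S − S₀) − (2κ²/(d−1)) Σ_n ‖p_n‖²`

HONEST FRAMING: exact (Metropolis-corrected) sampling algorithms for lattice gauge theory;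
figures of merit are autocorrelation/cost numbers at stated couplings and volumes; no
continuum-physics claim.

Venture `LatticeQCDFlow` (cell pub-lqcd), topic `Exactness`; FANOUT row 7 (`s0-cpn-null`: the
S0-D1 rung — 2D CP⁹, Lüscher's LO trivializing map inside HMC, Engel–Schaefer 2011).  NEW WORK of
the cell over Mathlib and the tree's `SphereGeodesicKick.lean` (`geodesicKick`, `tangentKick`,
`inner_tangentKick`), `SphereLOFlowAction.lean` (`esAction`, `localField`),
`SphereLOFlowDivergence.lean` (`hasDerivAt_kickJac_loStep`, `siteDiv_loGenerator`) and
`KickAngleJacobian.lean` (`kickJac`, `kickJac_zero_left`); nothing is cited as a fact.  Printed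
counterparts, NAMED ONLY: Engel–Schaefer, Comput. Phys. Commun. 182 (2011) 2107, §3 eq. (14) (the
transformed weight `exp(−S[𝓕(x′)] + ln 𝒥[x′])`), eqs. (15)–(18); M. Lüscher, Commun. Math. Phys. 293
(2010) 899, §4.1 eqs. (4.1)–(4.2) (`ln det 𝓕_{t*} = t S(𝓕_t) + C_t` ⇒ the pulled-back action is
`(1 − t) S + const` to the order considered).

## Content (finite-dimensional `E`, `d = dim E`; couplings with no self-coupling and adjoint
pairs; configurations on the product of unit spheres; `p_n = tangentKick (J_n x) (x n)`,
`a = κ/(d−1)`; the SIMULTANEOUS Euler step `F_ε(x)_n = geodesicKick (ε a) (J_n x) (x n)` of the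
leading-order flow at every site, fields frozen at `x`)

* `geodesicKick_zero_left`, **`hasDerivAt_geodesicKick_zero`** — `F_0 = id` and
  `d/dε geodesicKick (ε a) J u |₀ = a · p`: the step moves each site with velocity `T_n = a p_n`
  (`SphereLOFlowAction.loGenerator_eq`).
* **`hasDerivAt_esAction_loStep`** — THE ACTION ALONG THE STEP:
  `d/dε S(F_ε x)|₀ = −2κ a Σ_n ‖p_n‖²` (`= Σ_n ⟪∇_n S, T_n⟫ = −‖F‖²/(2(d−1))` with `F_n = 2κ p_n` the
  HMC force of E–S eq. (13): the map moves every site down the gradient, lowering the action at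
  first order by a term of second order in `κ`).
* **`hasDerivAt_sum_log_kickJac_loStep`** — THE LOG-JACOBIAN ALONG THE STEP (`dim E = m + 2`,
  sites off the poles of their local fields): `d/dε Σ_n ln 𝒥_n(ε)|₀ = S(x) − S₀`, `𝒥_n(ε) =
  kickJac (ε a ‖J_n‖) m θ'_n` the printed per-site Jacobian (E–S eq. (18)) — Lüscher's (4.1) at
  leading order, from `SphereLOFlowDivergence`.
* **`hasDerivAt_effectiveAction_loStep`** — LEADING-ORDER TRIVIALIZATION AT FIRST ORDER IN THE STEP:
  for the effective action of the field-transformed theory `S_eff(ε) = S(F_ε x) − Σ_n ln 𝒥_n(ε)`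
  (E–S eq. (14)), `d/dε S_eff|₀ = −(S(x) − S₀) − (2κ²/(m+1)) Σ_n ‖p_n‖²`: the fluctuating part of
  the action is removed at unit rate, the remainder being of second order in the coupling `κ = Nβ`
  — the sense in which the map trivializes "to leading order".

NOT CLAIMED: anything at finite `ε` or about `O(ε²)` terms; that the sequential sweep of the code
has the same first-order log-Jacobian as the simultaneous step used here for `S∘F_ε` (at first
order the partial updates do not contribute, but that bookkeeping is not typed); the exact
finite-step statements (tree: `SphereKickJacobian*`, `SphereSweepTHMC*`); anything quantitative
about forces, acceptance or autocorrelations.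
-/

noncomputable section

namespace Summit.Ventures.LatticeQCDFlow.Exactness

open NormedSpace Filter Real InnerProductGeometry
open scoped RealInnerProductSpace Topology

variable {E : Type*} [NormedAddCommGroup E] [InnerProductSpace ℝ E]

/-! ## §1 The Euler step as a curve in the step size: value and velocity at `ε = 0` -/

section Kick

/-- At step `0` the geodesic kick is the identity. -/
theorem geodesicKick_zero_left (J u : E) : geodesicKick 0 J u = u := by
  simp [geodesicKick]

/-- **The velocity of the Euler step**: `d/dε geodesicKick (ε a) J u |₀ = a • tangentKick J u`
(`= T`, the leading-order generator when `a = κ/(d−1)` and `J = J_n x`). -/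
theorem hasDerivAt_geodesicKick_zero (a : ℝ) (J u : E) :
    HasDerivAt (fun ε : ℝ => geodesicKick (ε * a) J u) (a • tangentKick J u) 0 := by
  set p := tangentKick J u with hp
  unfold geodesicKick
  rw [← hp]
  -- the phase `ε ↦ ε a ‖p‖`
  have hφ : HasDerivAt (fun ε : ℝ => ε * a * ‖p‖) (a * ‖p‖) 0 := by
    have h := hasDerivAt_mul_const (a * ‖p‖) (x := (0 : ℝ))
    have hf : (fun ε : ℝ => ε * a * ‖p‖) = fun ε => ε * (a * ‖p‖) := by funext ε; ring
    rw [hf]; exact h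
  have hcos : HasDerivAt (fun ε : ℝ => Real.cos (ε * a * ‖p‖)) 0 0 := by
    have h := hφ.cos
    simp only [zero_mul, Real.sin_zero, neg_zero] at h
    exact h
  have hsin : HasDerivAt (fun ε : ℝ => Real.sin (ε * a * ‖p‖) / ‖p‖) (a * ‖p‖ / ‖p‖) 0 := by
    have h := hφ.sin.div_const ‖p‖
    simp only [zero_mul, Real.cos_zero, one_mul] at h
    exact h
  have h := (hcos.smul_const u).add (hsin.smul_const p)
  simp only [zero_smul, zero_add] at h
  rcases eq_or_ne p 0 with hp0 | hp0
  · -- no tangential field: the curve is constant and `a • p = 0`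
    rw [hp0, smul_zero]
    have hconst : (fun ε : ℝ => Real.cos (ε * a * ‖(0 : E)‖) • u +
        (Real.sin (ε * a * ‖(0 : E)‖) / ‖(0 : E)‖) • (0 : E)) = fun _ => u := by
      funext ε; simp
    rw [hconst]
    exact hasDerivAt_const 0 u
  · have hn : ‖p‖ ≠ 0 := norm_ne_zero_iff.2 hp0
    rw [mul_div_assoc, div_self hn, mul_one] at h
    exact h

end Kick

/-! ## §2 The action along the simultaneous Euler step -/

section Action

variable {Λ : Type*} [Fintype Λ] {U : Λ → Λ → (E →L[ℝ] E)}

/-- A continuous linear map applied to a differentiable curve. -/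
theorem hasDerivAt_clm_comp (L : E →L[ℝ] E) {g : ℝ → E} {g' : E} {t : ℝ}
    (hg : HasDerivAt g g' t) : HasDerivAt (fun s => L (g s)) (L g') t :=
  L.hasFDerivAt.comp_hasDerivAt t hg

/-- **The action along the step, raw form**: for site curves `y_n(ε)` with `y_n(0) = x_n` and
velocities `v_n`, `d/dε S(y(ε))|₀ = −κ Σ_n (⟪x_n, Σ_m U_{nm} v_m⟫ + ⟪v_n, J_n x⟫)`. -/
theorem hasDerivAt_esAction_comp (κ S₀ : ℝ) (U : Λ → Λ → (E →L[ℝ] E)) {y : Λ → ℝ → E}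
    {x v : Λ → E} (hy : ∀ n, HasDerivAt (y n) (v n) 0) (hy0 : ∀ n, y n 0 = x n) :
    HasDerivAt (fun ε => esAction κ S₀ U (fun n => y n ε))
      (-κ * ∑ n, (⟪x n, ∑ m, U n m (v m)⟫ + ⟪v n, localField U n x⟫)) 0 := by
  unfold esAction localField
  have hJ : ∀ n, HasDerivAt (fun ε => ∑ m, U n m (y m ε)) (∑ m, U n m (v m)) 0 := fun n =>
    HasDerivAt.fun_sum fun m _ => hasDerivAt_clm_comp (U n m) (hy m)
  have hterm : ∀ n, HasDerivAt (fun ε => ⟪y n ε, ∑ m, U n m (y m ε)⟫)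
      (⟪x n, ∑ m, U n m (v m)⟫ + ⟪v n, ∑ m, U n m (x m)⟫) 0 := by
    intro n
    have h := (hy n).inner ℝ (hJ n)
    simp only [hy0] at h
    exact h
  have hsum := HasDerivAt.fun_sum (u := Finset.univ) fun n _ => hterm n
  exact (hsum.const_mul (-κ)).add_const S₀

/-- **The action along the simultaneous leading-order Euler step.**  On the product of unit
spheres, with adjoint-pair couplings, `F_ε(x)_n = geodesicKick (ε a) (J_n x) (x n)`:
`d/dε S(F_ε x)|₀ = −2κ a Σ_n ‖p_n‖²`, `p_n = tangentKick (J_n x) (x n)` — the site enters its own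
term and its neighbours' terms (the `2`), and `⟪J_n, p_n⟫ = ‖p_n‖²`. -/
theorem hasDerivAt_esAction_loStep (hUadj : ∀ m n (v w : E), ⟪U m n v, w⟫ = ⟪v, U n m w⟫)
    (κ S₀ a : ℝ) {x : Λ → E} (hx : ∀ n, ‖x n‖ = 1) :
    HasDerivAt (fun ε : ℝ => esAction κ S₀ U
        (fun n => geodesicKick (ε * a) (localField U n x) (x n)))
      (-(2 * κ * a) * ∑ n, ‖tangentKick (localField U n x) (x n)‖ ^ 2) 0 := by
  set v : Λ → E := fun n => a • tangentKick (localField U n x) (x n) with hv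
  have hy : ∀ n, HasDerivAt (fun ε : ℝ => geodesicKick (ε * a) (localField U n x) (x n)) (v n) 0 :=
    fun n => hasDerivAt_geodesicKick_zero a _ _
  have hy0 : ∀ n, (fun ε : ℝ => geodesicKick (ε * a) (localField U n x) (x n)) 0 = x n := fun n => by
    simp only [zero_mul, geodesicKick_zero_left]
  have h := hasDerivAt_esAction_comp κ S₀ U hy hy0
  refine h.congr_deriv ?_
  -- `Σ_n ⟪x_n, Σ_m U_{nm} v_m⟫ = Σ_m ⟪J_m x, v_m⟫` by the adjoint-pair property
  have h1 : ∑ n, ⟪x n, ∑ m, U n m (v m)⟫ = ∑ m, ⟪localField U m x, v m⟫ := by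
    simp_rw [inner_sum]
    rw [Finset.sum_comm]
    refine Finset.sum_congr rfl fun m _ => ?_
    rw [localField, sum_inner]
    refine Finset.sum_congr rfl fun n _ => ?_
    rw [← real_inner_comm (x n) ((U n m) (v m)), hUadj, real_inner_comm]
  have h2 : ∀ n, ⟪localField U n x, v n⟫ = a * ‖tangentKick (localField U n x) (x n)‖ ^ 2 := by
    intro n
    rw [hv, real_inner_smul_right, inner_tangentKick _ (hx n)]
  rw [Finset.sum_add_distrib, h1, ← Finset.sum_add_distrib, Finset.mul_sum, Finset.mul_sum]
  refine Finset.sum_congr rfl fun n _ => ?_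
  rw [real_inner_comm (localField U n x) (v n), h2]
  ring

end Action

/-! ## §3 The log-Jacobian along the step and the effective action -/

section Effective

variable {Λ : Type*} [Fintype Λ] [DecidableEq Λ] [FiniteDimensional ℝ E]
  {U : Λ → Λ → (E →L[ℝ] E)}

/-- **The log-Jacobian along the step** (`dim E = m + 2`, every site off the poles of its local
field): `d/dε Σ_n ln 𝒥_n(ε)|₀ = S(x) − S₀`, `𝒥_n(ε) = kickJac (ε (κ/(m+1)) ‖J_n x‖) m θ'_n` the
printed per-site Jacobian of E–S eq. (18) — each factor is `1` at `ε = 0` and its derivative there is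
`div_n T_n = −κ ⟪J_n x, x_n⟫` (`SphereLOFlowDivergence.hasDerivAt_kickJac_loStep`). -/
theorem hasDerivAt_sum_log_kickJac_loStep (hU0 : ∀ n, U n n = 0)
    (hUadj : ∀ m n (v w : E), ⟪U m n v, w⟫ = ⟪v, U n m w⟫) {m : ℕ}
    (hm : Module.finrank ℝ E = m + 2) (κ S₀ : ℝ) {x : Λ → E} (hx : ∀ n, ‖x n‖ = 1)
    (hθ : ∀ n, angle (localField U n x) (x n) ∈ Set.Ioo 0 π) :
    HasDerivAt (fun ε : ℝ => ∑ n, Real.log (kickJac (ε * (κ / ((m : ℝ) + 1)) * ‖localField U n x‖) m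
        (angle (localField U n x) (x n))))
      (esAction κ S₀ U x - S₀) 0 := by
  have hd : 2 ≤ Module.finrank ℝ E := by omega
  rw [← sum_siteDiv_loGenerator hU0 hUadj hd κ S₀ hx]
  refine HasDerivAt.fun_sum fun n _ => ?_
  have h := hasDerivAt_kickJac_loStep hU0 hUadj hm κ S₀ (hx n) (hθ n)
  have h1 : kickJac ((0 : ℝ) * (κ / ((m : ℝ) + 1)) * ‖localField U n x‖) m
      (angle (localField U n x) (x n)) = 1 := by
    rw [zero_mul, zero_mul, kickJac_zero_left m (hθ n)]
  have hlog := h.log (by rw [h1]; exact one_ne_zero)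
  rw [h1, div_one] at hlog
  exact hlog

/-- **Leading-order trivialization, at first order in the step.**  `dim E = m + 2` (so
`d − 1 = m + 1`), couplings with no self-coupling and adjoint pairs, `x` on the product of unit
spheres with every site off the poles of its local field.  The effective action of the
field-transformed theory along the simultaneous Euler step of the leading-order flow,
`S_eff(ε) = S(F_ε x) − Σ_n ln 𝒥_n(ε)` (E–S eq. (14)), satisfies
`d/dε S_eff|₀ = −(S(x) − S₀) − (2κ²/(m+1)) Σ_n ‖p_n‖²`: the action's fluctuating part is removed
at unit rate (Lüscher's `t S` in eq. (4.1)), up to a term of second order in the coupling. -/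
theorem hasDerivAt_effectiveAction_loStep (hU0 : ∀ n, U n n = 0)
    (hUadj : ∀ m n (v w : E), ⟪U m n v, w⟫ = ⟪v, U n m w⟫) {m : ℕ}
    (hm : Module.finrank ℝ E = m + 2) (κ S₀ : ℝ) {x : Λ → E} (hx : ∀ n, ‖x n‖ = 1)
    (hθ : ∀ n, angle (localField U n x) (x n) ∈ Set.Ioo 0 π) :
    HasDerivAt (fun ε : ℝ =>
        esAction κ S₀ U (fun n => geodesicKick (ε * (κ / ((m : ℝ) + 1))) (localField U n x) (x n)) -
          ∑ n, Real.log (kickJac (ε * (κ / ((m : ℝ) + 1)) * ‖localField U n x‖) m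
            (angle (localField U n x) (x n))))
      (-(esAction κ S₀ U x - S₀) -
        2 * κ ^ 2 / ((m : ℝ) + 1) * ∑ n, ‖tangentKick (localField U n x) (x n)‖ ^ 2) 0 := by
  have hS := hasDerivAt_esAction_loStep hUadj κ S₀ (κ / ((m : ℝ) + 1)) hx
  have hJ := hasDerivAt_sum_log_kickJac_loStep hU0 hUadj hm κ S₀ hx hθ
  refine (hS.sub hJ).congr_deriv ?_
  ring

end Effective

end Summit.Ventures.LatticeQCDFlow.Exactness

end
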